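import Summits.QuantumAdvantage.QuantumAdvantage.Theorems.PurityDialLawB

/-! # PurityDialLawC — part 3/13 (mechanical split for landing of `PurityDialLaw`; content verbatim; scopes re-opened with their variables) -/

set_option linter.dupNamespace false
noncomputable section

namespace Summit.QuantumAdvantage.QuantumAdvantage.Theorems.PurityDialLaw
open Classical Finset Summit.QuantumAdvantage.AdviceFreeQNC0
open Literature.Computability.MetaComplexity Literature.Computability.MetaComplexity.Smolensky
open Literature.Computability.Complexity (parityFn)

section Necessity

variable {m : ℕ}

/-- Hamming weight as a `Finset` cardinality (definitionally `GateFn.numOnes`). -/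
def wt (z : Fin m → Bool) : ℕ := (univ.filter fun i => z i = true).card

/-- Purity-dial helper `wt_le` (lens-4 g6 PurityDialLaw v12 twin; see the enclosing section docstring). -/
theorem wt_le (z : Fin m → Bool) : wt z ≤ m := by
  unfold wt; exact (card_le_univ _).trans (by rw [Fintype.card_fin])

/-- Purity-dial helper `parityFn_eq_decide_wt` (lens-4 g6 PurityDialLaw v12 twin; see the enclosing section docstring). -/
theorem parityFn_eq_decide_wt (z : Fin m → Bool) : parityFn m z = decide (wt z % 2 = 1) := rfl

/-- the weight level `k` of the cube has `C(m,k)` points. -/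
theorem card_filter_wt_eq (m k : ℕ) :
    (univ.filter fun z : Fin m → Bool => wt z = k).card = m.choose k := by
  have h : m.choose k = ((univ : Finset (Fin m)).powersetCard k).card := by
    rw [card_powersetCard, card_univ, Fintype.card_fin]
  rw [h]
  symm
  refine card_bij' (fun s _ => fun i => decide (i ∈ s)) (fun z _ => univ.filter fun i => z i = true)
    ?_ ?_ ?_ ?_
  · intro s hs
    rw [mem_powersetCard] at hs
    rw [mem_filter]
    refine ⟨mem_univ _, ?_⟩
    unfold wt
    rw [← hs.2]
    congr 1; ext i; simp
  · intro z hz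
    rw [mem_filter] at hz
    rw [mem_powersetCard]
    exact ⟨subset_univ _, hz.2⟩
  · intro s hs; ext i; simp
  · intro z hz; ext i; simp

/-- one base-`p` digit step: `x ≡ −1 (mod p^{j+1})` iff its last digit is `p − 1` and `x / p ≡ −1 (mod p^j)`. -/
theorem mod_pow_succ_eq_iff {p j x : ℕ} (hp : 2 ≤ p) :
    x % p ^ (j + 1) = p ^ (j + 1) - 1 ↔ x % p = p - 1 ∧ x / p % p ^ j = p ^ j - 1 := by
  have hQ : 1 ≤ p ^ j := Nat.one_le_pow _ _ (by omega)
  rw [pow_succ', Nat.mod_mul]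
  have h1 : p * (p ^ j - 1) = p * p ^ j - p := Nat.mul_sub_one p (p ^ j)
  have hpQ : p ≤ p * p ^ j := Nat.le_mul_of_pos_right p hQ
  have hr : x % p < p := Nat.mod_lt x (by omega)
  have hY : x / p % p ^ j < p ^ j := Nat.mod_lt _ (by omega)
  constructor
  · intro h
    rcases Nat.lt_trichotomy (x / p % p ^ j) (p ^ j - 1) with hlt | heq | hgt
    · exfalso
      have h2 : p * (x / p % p ^ j + 1) ≤ p * (p ^ j - 1) := Nat.mul_le_mul_left p (by omega)
      rw [Nat.mul_succ] at h2
      omega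
    · refine ⟨?_, heq⟩
      rw [heq, h1] at h
      omega
    · omega
  · rintro ⟨hr', hYQ⟩
    rw [hr', hYQ, h1]
    omega

/-- **Lucas for the all-`(p−1)` digit string:** `C(x, p^j − 1) ≡ [x ≡ −1 (mod p^j)] (mod p)`. -/
theorem choose_pow_sub_one_modEq (p : ℕ) [hp : Fact p.Prime] (j : ℕ) :
    ∀ x : ℕ, x.choose (p ^ j - 1) ≡ (if x % p ^ j = p ^ j - 1 then 1 else 0) [MOD p] := by
  induction j with
  | zero => intro x; simp [Nat.ModEq, Nat.mod_one]
  | succ j ih =>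
    intro x
    have hp2 : 2 ≤ p := hp.out.two_le
    have hQ : 1 ≤ p ^ j := Nat.one_le_pow _ _ (by omega)
    have hpQ : p ≤ p * p ^ j := Nat.le_mul_of_pos_right p hQ
    have e : p ^ (j + 1) - 1 = p * (p ^ j - 1) + (p - 1) := by
      rw [pow_succ', Nat.mul_sub_one]; omega
    have hk1 : (p ^ (j + 1) - 1) % p = p - 1 := by
      rw [e, Nat.mul_add_mod_self_left]; exact Nat.mod_eq_of_lt (by omega)
    have hk2 : (p ^ (j + 1) - 1) / p = p ^ j - 1 := by
      rw [e, Nat.mul_add_div (by omega), Nat.div_eq_of_lt (by omega : p - 1 < p), add_zero]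
    have key := Choose.choose_modEq_choose_mod_mul_choose_div_nat (n := x) (k := p ^ (j + 1) - 1) (p := p)
    rw [hk1, hk2] at key
    have h3 : (x % p).choose (p - 1) = if x % p = p - 1 then 1 else 0 := by
      split_ifs with h
      · rw [h, Nat.choose_self]
      · exact Nat.choose_eq_zero_of_lt (by have := Nat.mod_lt x (by omega : 0 < p); omega)
    rw [h3] at key
    refine key.trans (((Nat.ModEq.refl (if x % p = p - 1 then 1 else 0)).mul (ih (x / p))).trans ?_)
    have hiff := mod_pow_succ_eq_iff (x := x) (j := j) hp2
    by_cases hA : x % p = p - 1 <;> by_cases hB : x / p % p ^ j = p ^ j - 1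
    · rw [if_pos hA, if_pos hB, if_pos (hiff.2 ⟨hA, hB⟩)]
    · rw [if_pos hA, if_neg hB, if_neg (fun h => hB (hiff.1 h).2)]
    · rw [if_neg hA, if_pos hB, if_neg (fun h => hA (hiff.1 h).1)]
    · rw [if_neg hA, if_neg hB, if_neg (fun h => hA (hiff.1 h).1)]

/-- … hence, in `𝔽_p`: `C(w + q − 1, q − 1) = [q ∣ w]` for `q = p^j`. -/
theorem choose_modq_indicator (p : ℕ) [hp : Fact p.Prime] (j w : ℕ) :
    (((w + (p ^ j - 1)).choose (p ^ j - 1) : ℕ) : ZMod p) = if p ^ j ∣ w then 1 else 0 := by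
  have h := (ZMod.natCast_eq_natCast_iff _ _ p).2 (choose_pow_sub_one_modEq p j (w + (p ^ j - 1)))
  rw [h]
  have hq : 1 ≤ p ^ j := Nat.one_le_pow _ _ hp.out.pos
  have hiff : (w + (p ^ j - 1)) % p ^ j = p ^ j - 1 ↔ p ^ j ∣ w := by
    constructor
    · intro hmod
      have hd := Nat.div_add_mod (w + (p ^ j - 1)) (p ^ j)
      rw [hmod] at hd
      exact ⟨(w + (p ^ j - 1)) / p ^ j, by omega⟩
    · rintro ⟨c, rfl⟩
      rw [Nat.mul_add_mod_self_left]; exact Nat.mod_eq_of_lt (by omega)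
  by_cases hd : p ^ j ∣ w
  · rw [if_pos (hiff.2 hd), if_pos hd, Nat.cast_one]
  · rw [if_neg (mt hiff.1 hd), if_neg hd, Nat.cast_zero]

/-- **the extremal family**: the MOD-`q` weight indicator `χ_q(z) = [q ∣ |z|]`. -/
def modqFn (q m : ℕ) (z : Fin m → Bool) : Bool := decide (q ∣ wt z)

/-- `χ_{p^j}` has `𝔽_p`-degree `≤ p^j − 1` (Lucas + Vandermonde: `χ_q = Σ_{k<q} C(q−1, q−1−k)·e_k`). -/
theorem hasDegF_modqFn (p : ℕ) [hp : Fact p.Prime] (j m : ℕ) :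
    HasDegF p (modqFn (p ^ j) m) (p ^ j - 1) := by
  set q := p ^ j with hq
  set P : (Fin m → Bool) → ZMod p := ∑ k ∈ range (q - 1 + 1),
    (((q - 1).choose (q - 1 - k) : ℕ) : ZMod p) • ∑ T ∈ (univ : Finset (Fin m)).powersetCard k, mono (ZMod p) T
    with hPdef
  have hP : P ∈ lowDeg (ZMod p) m (q - 1) := by
    refine Submodule.sum_mem _ fun k hk => Submodule.smul_mem _ _ (Submodule.sum_mem _ fun T hT => ?_)
    refine mono_mem_lowDeg ?_
    rw [(mem_powersetCard.1 hT).2]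
    have := mem_range.1 hk; omega
  have hPz : ∀ z, P z = if modqFn q m z then 1 else 0 := by
    intro z
    have hv : ((((wt z) + (q - 1)).choose (q - 1) : ℕ) : ZMod p) =
        ∑ k ∈ range (q - 1 + 1), (((q - 1).choose (q - 1 - k) : ℕ) : ZMod p) * (((wt z).choose k : ℕ) : ZMod p) := by
      rw [Nat.add_choose_eq, Finset.Nat.sum_antidiagonal_eq_sum_range_succ
        (fun a b => (wt z).choose a * (q - 1).choose b)]
      push_cast
      exact Finset.sum_congr rfl fun k _ => mul_comm _ _
    rw [hPdef, Finset.sum_apply]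
    simp only [Pi.smul_apply, sum_mono_powersetCard_apply, smul_eq_mul]
    unfold wt at hv
    rw [← hv]
    have := choose_modq_indicator p j ((univ.filter fun i => z i = true).card)
    rw [← hq] at this
    rw [this]
    unfold modqFn wt
    by_cases hd : q ∣ (univ.filter fun i => z i = true).card <;> simp [hd]
  unfold HasDegF
  have : (fun z => if modqFn q m z then (1 : ZMod p) else 0) = P := funext fun z => (hPz z).symm
  rw [this]; exact hP

/-- **Hoeffding tail for the weight** (from `Literature.Probability.Moments.hoeffding_count_pi`):
`#{z : t ≤ σ·(|z| − m/2)} ≤ e^{−2t²/m}·2^m` for `σ = ±1`. -/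
theorem card_wt_tail_le (m : ℕ) (hm : 0 < m) {σ : ℝ} (hσ : σ = 1 ∨ σ = -1) {t : ℝ} (ht : 0 ≤ t) :
    ((univ.filter fun z : Fin m → Bool => t ≤ σ * ((wt z : ℝ) - m / 2)).card : ℝ) ≤
      Real.exp (-(2 * t ^ 2 / m)) * 2 ^ m := by
  have habsσ : |σ| = 1 := by rcases hσ with h | h <;> simp [h]
  have H := Literature.Probability.Moments.hoeffding_count_pi (ι := Fin m) (κ := fun _ => Bool)
    (fun _ b => σ * ((if b then (1 : ℝ) else 0) - 1 / 2)) (fun _ => 1 / 2)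
    (fun i => by simp only [Fintype.sum_bool, Bool.false_eq_true, ite_true, ite_false]; ring) (fun i b => by
      rw [abs_mul, habsσ, one_mul]; (cases b <;> simp); rw [abs_le]; constructor <;> norm_num) ht
    (by
      simp only [sum_const, card_univ, Fintype.card_fin, nsmul_eq_mul]
      have : (0 : ℝ) < m := by exact_mod_cast hm
      positivity)
  have hsum : ∀ z : Fin m → Bool, ∑ i, σ * ((if z i then (1 : ℝ) else 0) - 1 / 2) = σ * ((wt z : ℝ) - m / 2) := by
    intro z
    rw [← Finset.mul_sum, Finset.sum_sub_distrib, Finset.sum_boole]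
    simp only [sum_const, card_univ, Fintype.card_fin, nsmul_eq_mul]
    unfold wt
    ring
  have hset : (univ.filter fun z : Fin m → Bool => t ≤ σ * ((wt z : ℝ) - m / 2)) =
      (univ.filter fun z : Fin m → Bool => t ≤ ∑ i, σ * ((if z i then (1 : ℝ) else 0) - 1 / 2)) :=
    filter_congr fun z _ => by rw [hsum]
  rw [hset]
  refine H.trans (le_of_eq ?_)
  simp only [sum_const, card_univ, Fintype.card_fin, nsmul_eq_mul, Fintype.card_bool, Nat.cast_ofNat,
    prod_const]
  congr 1
  congr 1
  field_simp

/-- the imbalance inequality behind the family: `e^{q/a} > 4aqR` once `q ≥ 24 a⁴ R + 1` (`a ≥ 1`). -/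
theorem exp_gt_of_large {a q R : ℕ} (ha : 1 ≤ a) (hq : 24 * a ^ 4 * R + 1 ≤ q) :
    (4 * a * q * R : ℝ) < Real.exp ((q : ℝ) / a) := by
  have ha' : (0 : ℝ) < a := by exact_mod_cast ha
  have hq0 : (0 : ℝ) < q := by exact_mod_cast (show 0 < q by omega)
  have h1 : (24 * a ^ 4 * R : ℝ) < q := by exact_mod_cast (show 24 * a ^ 4 * R < q by omega)
  have h3 := Real.pow_div_factorial_le_exp ((q : ℝ) / a) (by positivity) 3
  have hfact : ((Nat.factorial 3 : ℕ) : ℝ) = 6 := by norm_num [Nat.factorial]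
  rw [hfact] at h3
  refine lt_of_lt_of_le ?_ h3
  rw [div_pow, div_div, lt_div_iff₀ (by positivity)]
  have h4 : (24 * a ^ 4 * R : ℝ) * q ^ 2 < q * q ^ 2 := mul_lt_mul_of_pos_right h1 (by positivity)
  have h5 : (24 * a ^ 4 * R : ℝ) * q ≤ 24 * a ^ 4 * R * q ^ 2 := by
    have hq1 : (1 : ℝ) ≤ q := by exact_mod_cast (show 1 ≤ q by omega)
    have : (q : ℝ) ≤ q ^ 2 := by nlinarith
    exact mul_le_mul_of_nonneg_left this (by positivity)
  nlinarith [h4, h5]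

/-- **the extremal computation**: on `m = 2aq` bits (`a` even, `q` odd, `q ≥ 24a⁴R + 1`) the even part of
`χ_q` outweighs `R` times its odd part. -/
theorem modqFn_unbalanced {a q R : ℕ} (ha : 2 ≤ a) (hae : a % 2 = 0) (hqo : q % 2 = 1)
    (hq : 24 * a ^ 4 * R + 1 ≤ q) : ¬ RelBal R (modqFn q (2 * a * q)) := by
  set m := 2 * a * q with hm
  have hq1 : 1 ≤ q := by omega
  have ha1 : 1 ≤ a := by omega
  have hm0 : 0 < m := by rw [hm]; positivity
  intro hbal
  -- (i) the central level `aq` lies in the even part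
  have heven : ((2 * a * q).choose (a * q) : ℝ) ≤ ((evenPart (modqFn q m)).card : ℝ) := by
    have hsub : (univ.filter fun z : Fin m → Bool => wt z = a * q) ⊆ evenPart (modqFn q m) := by
      intro z hz
      rw [mem_filter] at hz
      unfold evenPart
      rw [mem_filter]
      refine ⟨mem_univ _, ?_, ?_⟩
      · unfold modqFn; rw [hz.2]; simp
      · rw [parityFn_eq_decide_wt, hz.2]
        have : a * q % 2 = 0 := by
          have e : a * q = 2 * (a / 2 * q) := by
            have h2 := Nat.div_add_mod a 2
            rw [hae, add_zero] at h2
            nth_rewrite 1 [← h2]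
            ring
          omega
        simp [this]
    have := card_le_card hsub
    rw [card_filter_wt_eq] at this
    exact_mod_cast this
  -- (ii) the odd part sits in the two Hoeffding tails at distance `q` from the centre
  have hodd : ((oddPart (modqFn q m)).card : ℝ) ≤ 2 * (Real.exp (-((q : ℝ) / a)) * 2 ^ m) := by
    set U := univ.filter fun z : Fin m → Bool => (q : ℝ) ≤ 1 * ((wt z : ℝ) - m / 2) with hU
    set L := univ.filter fun z : Fin m → Bool => (q : ℝ) ≤ (-1) * ((wt z : ℝ) - m / 2) with hL
    have hsub : oddPart (modqFn q m) ⊆ U ∪ L := by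
      intro z hz
      unfold oddPart at hz
      rw [mem_filter] at hz
      obtain ⟨_, hf, hpar⟩ := hz
      unfold modqFn at hf
      rw [decide_eq_true_eq] at hf
      obtain ⟨k, hk⟩ := hf
      rw [parityFn_eq_decide_wt, decide_eq_true_eq, hk] at hpar
      have hka : k ≠ a := by
        intro hka'
        rw [hka'] at hpar
        have e : q * a = 2 * (q * (a / 2)) := by
          have h2 := Nat.div_add_mod a 2
          rw [hae, add_zero] at h2
          nth_rewrite 1 [← h2]
          ring
        omega
      have hmid : ((m : ℝ) / 2) = (a * q : ℕ) := by rw [hm]; push_cast; ring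
      rw [mem_union, hU, hL, mem_filter, mem_filter]
      rcases Nat.lt_or_gt_of_ne hka with hlt | hgt
      · right
        refine ⟨mem_univ _, ?_⟩
        have h1 : q * k + q ≤ q * a := by
          have := Nat.mul_le_mul_left q (show k + 1 ≤ a by omega); rw [Nat.mul_succ] at this; exact this
        rw [hmid, hk]
        have h1' : ((q * k : ℕ) : ℝ) + q ≤ ((a * q : ℕ) : ℝ) := by
          rw [mul_comm a q]; exact_mod_cast h1
        linarith
      · left
        refine ⟨mem_univ _, ?_⟩
        have h1 : q * a + q ≤ q * k := by
          have := Nat.mul_le_mul_left q (show a + 1 ≤ k by omega); rw [Nat.mul_succ] at this; exact this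
        rw [hmid, hk]
        have h1' : ((a * q : ℕ) : ℝ) + q ≤ ((q * k : ℕ) : ℝ) := by
          rw [mul_comm a q]; exact_mod_cast h1
        linarith
    have hq0 : (0 : ℝ) ≤ q := Nat.cast_nonneg q
    have hUle := card_wt_tail_le m hm0 (σ := 1) (Or.inl rfl) hq0
    have hLle := card_wt_tail_le m hm0 (σ := -1) (Or.inr rfl) hq0
    have hexp : Real.exp (-(2 * (q : ℝ) ^ 2 / m)) = Real.exp (-((q : ℝ) / a)) := by
      congr 1; rw [hm]; push_cast
      have ha' : (a : ℝ) ≠ 0 := by positivity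
      have hq' : (q : ℝ) ≠ 0 := by positivity
      field_simp
    rw [hexp] at hUle hLle
    calc ((oddPart (modqFn q m)).card : ℝ) ≤ ((U ∪ L).card : ℝ) := by exact_mod_cast card_le_card hsub
      _ ≤ (U.card : ℝ) + (L.card : ℝ) := by exact_mod_cast card_union_le U L
      _ ≤ _ := by rw [hU, hL]; linarith
  -- (iii) central binomial from below: `2^m ≤ 2aq · C(2aq, aq)`
  have hcen : (2 : ℝ) ^ m ≤ 2 * (a * q : ℕ) * ((2 * a * q).choose (a * q) : ℝ) := by
    have h := Nat.four_pow_le_two_mul_self_mul_centralBinom (a * q) (by positivity)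
    rw [Nat.centralBinom_eq_two_mul_choose, show 2 * (a * q) = 2 * a * q by ring] at h
    have h' : ((4 ^ (a * q) : ℕ) : ℝ) ≤ ((2 * a * q * (2 * a * q).choose (a * q) : ℕ) : ℝ) := by
      exact_mod_cast h
    have e4 : ((4 ^ (a * q) : ℕ) : ℝ) = (2 : ℝ) ^ m := by
      rw [hm, show 2 * a * q = 2 * (a * q) by ring, pow_mul (2 : ℝ) 2 (a * q)]; norm_num
    rw [e4] at h'
    refine h'.trans (le_of_eq ?_)
    push_cast; ring
  -- (iv) combine with the balance hypothesis `#even ≤ R · #odd`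
  have hb : ((evenPart (modqFn q m)).card : ℝ) ≤ R * ((oddPart (modqFn q m)).card : ℝ) := by
    exact_mod_cast hbal.2
  have hchain : (2 : ℝ) ^ m ≤ 2 * (a * q : ℕ) * (R * (2 * (Real.exp (-((q : ℝ) / a)) * 2 ^ m))) := by
    calc (2 : ℝ) ^ m ≤ 2 * (a * q : ℕ) * ((2 * a * q).choose (a * q) : ℝ) := hcen
      _ ≤ 2 * (a * q : ℕ) * ((evenPart (modqFn q m)).card : ℝ) := by gcongr
      _ ≤ 2 * (a * q : ℕ) * (R * ((oddPart (modqFn q m)).card : ℝ)) := by gcongr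
      _ ≤ 2 * (a * q : ℕ) * (R * (2 * (Real.exp (-((q : ℝ) / a)) * 2 ^ m))) := by gcongr
  have hE := exp_gt_of_large ha1 hq
  have hpos : (0 : ℝ) < (2 : ℝ) ^ m := by positivity
  have hexp0 : (0 : ℝ) < Real.exp ((q : ℝ) / a) := Real.exp_pos _
  rw [Real.exp_neg] at hchain
  -- `2^m ≤ 4aqR e^{-q/a} 2^m` contradicts `4aqR < e^{q/a}`
  have h1 : (1 : ℝ) ≤ 4 * a * q * R * (Real.exp ((q : ℝ) / a))⁻¹ := by
    have := hchain
    push_cast at this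
    nlinarith [this, hpos]
  rw [← div_eq_mul_inv, le_div_iff₀ hexp0, one_mul] at h1
  linarith

/-- **Theorem (the dial from below).** For every odd prime `p` and EVERY ratio `R`, the linear-threshold law fails:
`¬ RelSmolLaw p R 1`.  (Witness: `χ_{p^j}` on `4(A+1)·p^j` bits, `j = 24·(2A+2)^4·R + 1`.) -/
theorem not_relSmolLaw_one (p : ℕ) [hp : Fact p.Prime] (hp2 : p ≠ 2) (R : ℕ) : ¬ RelSmolLaw p R 1 := by
  rintro ⟨A, hlaw⟩
  have hp3 : 3 ≤ p := by
    have := hp.out.two_le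
    omega
  set a := 2 * (A + 1) with ha
  set j := 24 * a ^ 4 * R + 1 with hj
  set q := p ^ j with hq
  have hqj : j < q := Nat.lt_pow_self (by omega)
  have hq1 : 1 ≤ q := Nat.one_le_pow _ _ (by omega)
  have hqo : q % 2 = 1 := by
    rw [hq]; exact Nat.odd_iff.1 (Odd.pow (Nat.odd_iff.2 ((hp.out.eq_two_or_odd).resolve_left hp2)))
  have hm : A * (q - 1 + 1) ^ 1 ≤ 2 * a * q := by
    rw [Nat.sub_add_cancel hq1, pow_one]
    exact Nat.mul_le_mul_right q (by omega)
  have hbal := hlaw (2 * a * q) (q - 1) hm (modqFn q (2 * a * q)) (by rw [hq]; exact hasDegF_modqFn p j _)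
  exact modqFn_unbalanced (R := R) (by omega) (by omega) hqo (by omega) hbal

/-- **Corollary (exponent floor of the dial).** Any true polynomial member of the dial has exponent `B ≥ 2`:
g5's `RelSmolOdd` (`B = 2`) is the STRONGEST candidate, and the residual `RelSmolPolyOdd` (`∃ B`) cannot be
witnessed below `B = 2`. -/
theorem two_le_of_relSmolLaw {p : ℕ} [Fact p.Prime] (hp2 : p ≠ 2) {R B : ℕ} (h : RelSmolLaw p R B) : 2 ≤ B := by
  by_contra hB
  exact not_relSmolLaw_one p hp2 R (relSmolLaw_mono le_rfl (by omega) h)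

end Necessity

/-- **Corollary (floor of the residual).** Every exponent `B` witnessing the residual `RelSmolPolyOdd` at a prime
`p ≥ 5` satisfies `B ≥ 2`: g5's `RelSmolOdd` (`B = 2`, census-predicted sharp) is the strongest live member. -/
theorem relSmolPolyOdd_floor (p : ℕ) [Fact p.Prime] (hp : 5 ≤ p) {B : ℕ} (h : RelSmolLaw p 3 B) : 2 ≤ B :=
  two_le_of_relSmolLaw (by omega) h

/-- **THE PURITY DIAL — summary theorem (all PROVED).**  For every odd prime `p`:
(i) purity end: the threshold `2d` fails for EVERY ratio (`purity_sharp`; and `2d+1` suffices for `R = ∞` by Beck–Li,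
`eq_false_of_pure`); (ii) linear floor: `τ d = A·(d+1)^B` fails for every `A`, every ratio and every `B ≤ 1`
(`not_relSmolLaw_one`); (iii) exponential ceiling: `τ d = (d+1)²·4^{d+1}` works at ratio `3` (`lawAt_exp`).
The residual `RelSmolPolyOdd` asks for a polynomial threshold strictly between (ii) and (iii). -/
theorem purityDial_summary (p : ℕ) [Fact p.Prime] (hp2 : p ≠ 2) :
    (∀ R, ¬ LawAt p R (fun d => 2 * d)) ∧
    (∀ R B, B ≤ 1 → ¬ RelSmolLaw p R B) ∧
    LawAt p 3 (fun d => (d + 1) ^ 2 * 4 ^ (d + 1)) :=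
  ⟨fun R => not_lawAt_two_mul p hp2 R,
   fun R _ hB h => not_relSmolLaw_one p hp2 R (relSmolLaw_mono le_rfl hB h),
   lawAt_exp p hp2⟩


/-- record against the tree: item 29180's exponent `2` cannot be lowered — for every prime `p ≥ 5` and every
constant `A`, the linear-threshold variant of `Theses.PolyFeatureDial.RelSmolOdd` fails (`B = 1` is theorem-false), so
29180 is the STRONGEST live polynomial member of the dial. -/
theorem relSmolOdd_linear_variant_false (p : ℕ) [Fact p.Prime] (hp : 5 ≤ p) :
    ¬ ∃ A : ℕ, ∀ m d : ℕ, A * (d + 1) ≤ m → ∀ f : (Fin m → Bool) → Bool, HasDegF p f d → RelBal 3 f := by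
  rintro ⟨A, hA⟩
  exact not_relSmolLaw_one p (by omega) 3 ⟨A, fun m d hm f hf => hA m d (by simpa using hm) f hf⟩

/-! ### §17 THE EXTREMISER CLASS OBEYS THE LAW AT EXPONENT 2: `q`-periodic symmetric functions

`symFn q m g : z ↦ g(|z| mod q)` — for `q = p^j` a class of `𝔽_p`-degree `≤ q − 1` (`hasDegF_symFn`) that contains
every extremiser of §14/§16 (`e_{p−1} mod p`, `χ_q`, the digit readers) — is `3`-balanced as soon as
`m ≥ 2q²(log₂ q + 3)` (ANY odd `q`; `relBal_three_symFn`): odd/even parts split along residues `mod 2q` (CRT, `q` odd)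
and every residue class of the weight `mod 2q` has `2^m/(2q) ± (2cos(π/2q))^m` points
(`TwoModuli.abs_card_filter_card_eq_sub_le'`, in the tree), while `cos(π/2q) ≤ 1 − 1/(2q²)`.  So NO SYMMETRIC
FUNCTION refutes the residual: a minimal counterexample to `RelSmolPolyOdd` is asymmetric. -/


end Summit.QuantumAdvantage.QuantumAdvantage.Theorems.PurityDialLaw
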